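import Summits.ResolutionOfSingularities.ResolutionOfSingularities.Theorems.FrobeniusClosingSteerLineageFrame
import Summits.ResolutionOfSingularities.ResolutionOfSingularities.Theorems.FrobeniusClosingSteerBadCurveLineage
import Summits.ResolutionOfSingularities.ResolutionOfSingularities.Theorems.FrobeniusClosingSteerLowTowerMoves
import Summits.ResolutionOfSingularities.ResolutionOfSingularities.Theorems.FrobeniusClosingSteerDivisorTriggerTwoChart
import Literature.AlgebraicGeometry.Resolution.QuadraticTransforms
import Literature.AlgebraicGeometry.Resolution.LocalBlowup
import Mathlib.RingTheory.Valuation.LocalSubring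
import Mathlib.RingTheory.LocalRing.ResidueField.Basic
import HarnessLib

/-!
# A bad curve of the LOW tower does not stay bad: its lineage becomes regular (D3c, W4.1 — F5 (ii)+(iii) assembled)

W4.1, crux `Steer` (stmt-ResolutionOfSingularities-16345), σ-line at `p = 2`, LOW half, piece **D3c = F5 TAMING**
(res-L0-w41-plan-1 RULINGS 18d/41; res-L0-w41-strat-2 §σ2.24 `LowTowerTamingTwo` over `IsLowTowerTwo`; tower = res-D-pv-012's
D3a). Theses-free, def-free. THE LINEAGE THEOREM ON THE CONCRETE TOWER: along a chain `A 0 ≤ A 1 ≤ ⋯` of local subrings of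
one field in which every step is a quadratic transform in an explicit chart (a POINT stage, `n ∈ pt`) or the identity (a CURVE
stage), follow a compatible family of non-maximal primes `𝔮 n ⊂ A n` (`𝔮 (n+1) ∩ A n = 𝔮 n`: a curve and its strict
transforms). If `A 0 ⧸ 𝔮 0` is an excellent curve germ (Noetherian local domain of dimension one with module-finite
normalisation) and there are infinitely many point stages, then `A n ⧸ 𝔮 n` is REGULAR for all large `n`.

Construction (F5 (ii) of res-L0-w41-idea-3's card 3 v3): the FRAME `Λ := (A 0)_{𝔮 0}` realised in the field (range of the
localisation map), `φ :=` its residue map; by induction along the chain `A n ≤ Λ` and `𝔮 n = A n ∩ 𝔪_Λ`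
(`BadCurveLineage.exists_div_of_quadraticTransform`, `…mem_iff_of_quadraticTransform`: off the exceptional prime a quadratic
transform is a local isomorphism); at a point stage the germs `φ(A n) → φ(A (n+1))` form a quadratic transform one level down
(res-D-pv-012's (M1) `LowTower.map_isQuadraticTransform`, the valuation ring supplied by Chevalley and the chart identified by
`DivisorTrigger.eq_locAtCentre_blowupRing`); then `LineageFrame.eventually_isRegularLocalRing_quotient_of_frame` (p519671,
engine `CurveLineage` p515973: Kollár 1.101 ring level).

No Theses file of W4.1 is imported; nothing here is a route item. OURS (the W4.1 engine), standard commutative algebra;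
NOT a statement of the manuscript under review [claim: Hironaka2017, status: under-review]. [cite: Kollar2007, §1.4, Thm. 1.101]
[cite: Cutkosky2014, §2.1, §2.2] [folklore]
-/

noncomputable section

-- `Summit.<S>.<S>.…` duplicates the summit name by design (single-problem summit).
set_option linter.dupNamespace false

open IsLocalRing Literature.AlgebraicGeometry.Resolution

namespace Summit.ResolutionOfSingularities.ResolutionOfSingularities.Theorems.SwitchingDichotomy.LowTamingGerms

variable {L : Type} [Field L]

/-! ## §1 Chevalley and the chart of a quadratic transform -/

/-- Some valuation ring of `L` dominates a given local subring (Chevalley, via Mathlib's `LocalSubring`). [folklore] -/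
theorem exists_valuationSubring_dominates (S : Subring L) [IsLocalRing S] :
    ∃ O : ValuationSubring L, SubringDominates S O.toSubring := by
  obtain ⟨O, hO⟩ := LocalSubring.exists_le_valuationSubring (LocalSubring.mk S)
  haveI : IsLocalRing O.toSubring := (inferInstance : IsLocalRing O)
  exact ⟨O, (subringDominates_iff S O.toSubring).mpr hO⟩

/-- **The quadratic transform in an explicit chart is the local ring at the centre of a valuation**: if `A ⊂ A'` is a
quadratic transform with chart element `x` (`A[𝔪_A/x] ⊆ A'`, elements of `A'` fractions of `A[𝔪_A/x]` with invertible
denominators, `A'` dominating `A`), then for ANY valuation ring `O` dominating `A'`: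
`A' = (A[𝔪_A/x])_{𝔪_O ∩ A[𝔪_A/x]}`, `A ≤ O`, and `𝔪_A/x ⊆ O`. [cite: Cutkosky2014, §2.2] -/
theorem eq_locAtCentre_of_chart {A A' : Subring L} [IsLocalRing A] [IsLocalRing A'] [IsNoetherianRing A]
    {x : L} (hxA : x ∈ A) (hxm : (⟨x, hxA⟩ : A) ∈ maximalIdeal A) (hx0 : x ≠ 0)
    (hB : blowupRing A x ≤ A')
    (hfrac : ∀ z ∈ A', ∃ a ∈ blowupRing A x, ∃ b ∈ blowupRing A x, b⁻¹ ∈ A' ∧ z = a / b)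
    (hdom : SubringDominates A A') {O : ValuationSubring L} (hO : SubringDominates A' O.toSubring) :
    A' = locAtCentre (blowupRing A x) O ∧ A ≤ O.toSubring ∧
      (∀ y : A, y ∈ maximalIdeal A → (y : L) / x ∈ O) ∧
      IsLocalBlowupAlong O A (maximalIdeal A) A' := by
  have hqt : IsQuadraticTransform A A' :=
    ⟨inferInstance, ⟨x, hxA⟩, hxm, fun h => hx0 (congrArg Subtype.val h), inferInstance, hB, hfrac, hdom⟩
  have halong : IsQuadraticTransformAlong O A A' :=
    hqt.along ⟨inferInstance, IsNoetherian.noetherian _⟩ hO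
  obtain ⟨_, hbl⟩ := halong
  have hAO : A ≤ O.toSubring := hbl.1
  have hdiv : ∀ y : A, y ∈ maximalIdeal A → (y : L) / x ∈ O := fun y hy =>
    hO.1 (hB (div_mem_blowupRing x hy))
  have hmax : ∀ y : A, y ∈ maximalIdeal A → O.valuation (y : L) ≤ O.valuation x := by
    intro y hy
    have h1 : O.valuation ((y : L) / x) ≤ 1 := (O.valuation_le_one_iff _).mpr (hdiv y hy)
    have hvx : O.valuation x ≠ 0 := (map_ne_zero _).mpr hx0
    rwa [map_div₀, div_le_one₀ (zero_lt_iff.mpr hvx)] at h1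
  exact ⟨DivisorTrigger.eq_locAtCentre_blowupRing hbl hxA hxm hx0 hmax, hAO, hdiv, hbl⟩

/-! ## §2 The lineage theorem on the tower -/

/-- **A bad curve does not stay bad.** See the module docstring: chain of local Noetherian subrings `A n` of `L`, point stages =
quadratic transforms in the chart `x n`, curve stages = identity; a compatible family of non-maximal primes `𝔮 n`; `A 0 ⧸ 𝔮 0`
an excellent curve germ; infinitely many point stages ⇒ `A n ⧸ 𝔮 n` regular for all large `n`.
[cite: Kollar2007, §1.4, Thm. 1.101] [cite: Cutkosky2014, §2.1] -/
theorem eventually_isRegularLocalRing_quotient_of_lineage (A : ℕ → Subring L)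
    [hAl : ∀ n, IsLocalRing (A n)] (hAN : ∀ n, IsNoetherianRing (A n))
    (x : ℕ → L) (pt : Set ℕ)
    (hx : ∀ n, ∃ hxA : x n ∈ A n, x n ≠ 0 ∧ (⟨x n, hxA⟩ : A n) ∈ maximalIdeal (A n))
    (hpt : ∀ n ∈ pt, blowupRing (A n) (x n) ≤ A (n + 1) ∧
      (∀ z ∈ A (n + 1), ∃ a ∈ blowupRing (A n) (x n), ∃ b ∈ blowupRing (A n) (x n),
        b⁻¹ ∈ A (n + 1) ∧ z = a / b) ∧
      SubringDominates (A n) (A (n + 1)))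
    (hcv : ∀ n ∉ pt, A (n + 1) = A n)
    (hle : ∀ n, A n ≤ A (n + 1))
    (𝔮 : (n : ℕ) → Ideal (A n)) [h𝔮 : ∀ n, (𝔮 n).IsPrime]
    (hchain : ∀ n, (𝔮 (n + 1)).comap (Subring.inclusion (hle n)) = 𝔮 n)
    (hne : ∀ n, 𝔮 n ≠ maximalIdeal (A n))
    (hloc : IsLocalRing (A 0 ⧸ 𝔮 0)) (hNq : IsNoetherianRing (A 0 ⧸ 𝔮 0)) (hdim : ringKrullDim (A 0 ⧸ 𝔮 0) = 1)
    (hfin : Module.Finite (A 0 ⧸ 𝔮 0) (integralClosure (A 0 ⧸ 𝔮 0) (FractionRing (A 0 ⧸ 𝔮 0))))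
    (hinf : pt.Infinite) :
    ∃ n₀, ∀ n, n₀ ≤ n → IsRegularLocalRing (A n ⧸ 𝔮 n) := by
  classical
  /- THE FRAME: `V = (A 0)_{𝔮 0}`, `j : V → L`, `Λ = j(V)`, `φ = residue ∘ j⁻¹`. -/
  set V := Localization.AtPrime (𝔮 0) with hV
  have hunit : ∀ s : (𝔮 0).primeCompl, IsUnit ((A 0).subtype s) := by
    intro s
    refine isUnit_iff_ne_zero.mpr fun h0 => s.2 ?_
    have : (s : A 0) = 0 := Subtype.ext h0
    rw [this]; exact Ideal.zero_mem _
  set j : V →+* L := IsLocalization.lift (M := (𝔮 0).primeCompl) (S := V) hunit with hj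
  have hjalg : ∀ a : A 0, j (algebraMap (A 0) V a) = (a : L) := fun a => IsLocalization.lift_eq hunit a
  have hjinj : Function.Injective j := by
    rw [hj, IsLocalization.lift_injective_iff]
    intro a b
    constructor
    · intro h
      have := (IsLocalization.injective V (𝔮 0).primeCompl_le_nonZeroDivisors) h
      rw [this]
    · intro h
      have : a = b := Subtype.ext h
      rw [this]
  set Λ : Subring L := j.range with hΛ
  have hjmem : ∀ v : V, j v ∈ Λ := fun v => ⟨v, rfl⟩
  -- `e : V ≃ Λ`
  set e : V ≃+* Λ := RingEquiv.ofBijective j.rangeRestrict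
    ⟨fun a b h => hjinj (congrArg Subtype.val h), RingHom.rangeRestrict_surjective j⟩ with he
  have he_apply : ∀ v : V, (e v : L) = j v := fun v => rfl
  have he_symm : ∀ (v : V), e.symm ⟨j v, hjmem v⟩ = v := fun v => by
    apply e.injective; rw [RingEquiv.apply_symm_apply]; exact Subtype.ext rfl
  set φ : Λ →+* ResidueField V := (IsLocalRing.residue V).comp e.symm.toRingHom with hφ
  have hφj : ∀ v : V, φ ⟨j v, hjmem v⟩ = IsLocalRing.residue V v := fun v => by
    change IsLocalRing.residue V (e.symm ⟨j v, hjmem v⟩) = _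
    rw [he_symm]
  have hker : ∀ r : Λ, φ r = 0 → ¬ IsUnit r := by
    intro r hr hu
    obtain ⟨v, hv⟩ : ∃ v : V, (⟨j v, hjmem v⟩ : Λ) = r := by
      obtain ⟨v, hv⟩ := RingHom.rangeRestrict_surjective j r
      exact ⟨v, by rw [← hv]; rfl⟩
    subst hv
    rw [hφj, IsLocalRing.residue_eq_zero_iff] at hr
    apply hr
    have : IsUnit (e.symm ⟨j v, hjmem v⟩) := hu.map e.symm
    rwa [he_symm] at this
  -- membership in `Λ` and in `ker φ`, read on `A 0`
  have hΛmem : ∀ {z : L} (a b : A 0), b ∉ 𝔮 0 → z * (b : L) = a →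
      ∃ hz : z ∈ Λ, (φ ⟨z, hz⟩ = 0 ↔ a ∈ 𝔮 0) := by
    intro z a b hb hzb
    have hb0 : (b : L) ≠ 0 := fun h => hb (by rw [show b = 0 from Subtype.ext h]; exact Ideal.zero_mem _)
    set v : V := IsLocalization.mk' V a (⟨b, hb⟩ : (𝔮 0).primeCompl) with hv
    have hjv : j v = z := by
      rw [hv, hj, IsLocalization.lift_mk'_spec]
      change (a : L) = (b : L) * z
      rw [← hzb, mul_comm]
    refine ⟨hjv ▸ hjmem v, ?_⟩
    have : (⟨z, hjv ▸ hjmem v⟩ : Λ) = ⟨j v, hjmem v⟩ := Subtype.ext hjv.symm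
    rw [this, hφj, IsLocalRing.residue_eq_zero_iff, hv,
      IsLocalization.AtPrime.mk'_mem_maximal_iff V (𝔮 0) a (⟨b, hb⟩ : (𝔮 0).primeCompl)]
  have hΛunit : ∀ r : Λ, φ r ≠ 0 → IsUnit r := by
    intro r hr
    have h1 : IsUnit (e.symm r) := (IsLocalRing.residue_ne_zero_iff_isUnit _).mp hr
    have h2 := h1.map e
    rwa [RingEquiv.apply_symm_apply] at h2
  /- THE INVARIANTS along the chain: `A n ≤ Λ` and `𝔮 n = A n ∩ ker φ`. -/
  have hinv : ∀ n, ∃ hn : A n ≤ Λ, ∀ z : A n, z ∈ 𝔮 n ↔ φ (Subring.inclusion hn z) = 0 := by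
    intro n
    induction n with
    | zero =>
      have h0 : ∀ z : A 0, ∃ hz : (z : L) ∈ Λ, (φ ⟨z, hz⟩ = 0 ↔ z ∈ 𝔮 0) := fun z =>
        hΛmem z 1 (fun h1 => (Ideal.ne_top_iff_one _).mp (Ideal.IsPrime.ne_top inferInstance) h1)
          (by rw [OneMemClass.coe_one, mul_one])
      refine ⟨fun z hz => (h0 ⟨z, hz⟩).1, fun z => ?_⟩
      obtain ⟨hz, hiff⟩ := h0 z
      exact hiff.symm
    | succ n ih =>
      obtain ⟨hn, hkn⟩ := ih
      by_cases hp : n ∈ pt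
      · -- point stage: quadratic transform in the chart `x n`; `𝔮 (n+1)` is off the exceptional prime
        obtain ⟨hB, hfrac, hdom⟩ := hpt n hp
        obtain ⟨hxA, hx0, hxm⟩ := hx n
        have hqt : IsQuadraticTransform (A n) (A (n + 1)) :=
          ⟨inferInstance, ⟨x n, hxA⟩, hxm, fun h => hx0 (congrArg Subtype.val h), inferInstance, hB, hfrac, hdom⟩
        have hneq : (𝔮 (n + 1)).comap (Subring.inclusion hqt.dominates.1) ≠ maximalIdeal (A n) := by
          rw [show hqt.dominates.1 = hle n from rfl, hchain n]; exact hne n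
        have hcomap : ∀ (b : L) (hb : b ∈ A n), (⟨b, hle n hb⟩ : A (n + 1)) ∉ 𝔮 (n + 1) →
            (⟨b, hb⟩ : A n) ∉ 𝔮 n := by
          intro b hb hbq hbq'
          rw [← hchain n, Ideal.mem_comap] at hbq'
          exact hbq hbq'
        -- `A (n+1) ≤ Λ`
        have hn1 : A (n + 1) ≤ Λ := by
          intro z hz
          obtain ⟨a, b, ha, hb, hbq, hb0, rfl⟩ :=
            BadCurveLineage.exists_div_of_quadraticTransform hqt (𝔮 (n + 1)) hneq hz
          have hφb : φ (Subring.inclusion hn ⟨b, hb⟩) ≠ 0 := fun h => hcomap b hb hbq ((hkn _).mpr h)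
          have hbinv : b⁻¹ ∈ Λ := ((isUnit_subring_iff_inv_mem _).mp (hΛunit _ hφb)).2
          rw [div_eq_mul_inv]
          exact Λ.mul_mem (hn ha) hbinv
        refine ⟨hn1, fun z => ?_⟩
        have hmul : ∀ (u : L) (hu : u ∈ A (n + 1)) (b a : L) (hb : b ∈ A n) (ha : a ∈ A n), u * b = a →
            φ (Subring.inclusion hn1 ⟨u, hu⟩) * φ (Subring.inclusion hn ⟨b, hb⟩) =
              φ (Subring.inclusion hn ⟨a, ha⟩) := by
          intro u hu b a hb ha hub
          rw [← map_mul]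
          congr 1
          exact Subtype.ext hub
        rw [BadCurveLineage.mem_iff_of_quadraticTransform hqt (𝔮 (n + 1)) hneq z.2]
        constructor
        · rintro ⟨a, b, ha, hb, hbq, haq, hzb⟩
          rw [hchain n] at haq
          have hφa : φ (Subring.inclusion hn ⟨a, ha⟩) = 0 := (hkn _).mp haq
          have hφb : φ (Subring.inclusion hn ⟨b, hb⟩) ≠ 0 := fun h => hcomap b hb hbq ((hkn _).mpr h)
          have h := hmul z z.2 b a hb ha hzb
          rw [hφa] at h
          exact (mul_eq_zero.mp h).resolve_right hφb
        · intro hφz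
          obtain ⟨a, b, ha, hb, hbq, hb0, hzab⟩ :=
            BadCurveLineage.exists_div_of_quadraticTransform hqt (𝔮 (n + 1)) hneq z.2
          have hzb : (z : L) * b = a := by rw [hzab, div_mul_cancel₀ _ hb0]
          refine ⟨a, b, ha, hb, hbq, ?_, hzb⟩
          rw [hchain n]
          apply (hkn _).mpr
          have h := hmul z z.2 b a hb ha hzb
          rw [hφz, zero_mul] at h
          exact h.symm
      · -- curve stage: `A (n+1) = A n`
        have heq : A (n + 1) = A n := hcv n hp
        have hn1 : A (n + 1) ≤ Λ := heq.le.trans hn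
        refine ⟨hn1, fun z => ?_⟩
        have hz' : (z : L) ∈ A n := heq.le z.2
        have h1 := hkn ⟨z, hz'⟩
        have h2 : (⟨(z : L), hz'⟩ : A n) ∈ 𝔮 n ↔ z ∈ 𝔮 (n + 1) := by
          rw [← hchain n, Ideal.mem_comap]
          exact Iff.of_eq (congrArg (· ∈ 𝔮 (n + 1)) (Subtype.ext rfl))
        rw [← h2, h1]
        exact Iff.of_eq (congrArg (fun w => φ w = 0) (Subtype.ext rfl))
  have hAΛ : ∀ n, A n ≤ Λ := fun n => (hinv n).1
  have hkerq : ∀ n (z : A n), z ∈ 𝔮 n ↔ φ (Subring.inclusion (hAΛ n) z) = 0 := fun n => (hinv n).2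
  /- THE GERMS: `G n := φ(A n)`; curve stage ⇒ equal, point stage ⇒ quadratic transform (pv-012 (M1)). -/
  have hG_curve : ∀ n, n ∉ pt →
      (φ.comp (Subring.inclusion (hAΛ (n + 1)))).range = (φ.comp (Subring.inclusion (hAΛ n))).range := by
    intro n hp
    have heq : A (n + 1) = A n := hcv n hp
    ext c
    simp only [RingHom.mem_range, RingHom.coe_comp, Function.comp_apply]
    constructor
    · rintro ⟨z, rfl⟩
      exact ⟨⟨z, heq.le z.2⟩, congrArg φ (Subtype.ext rfl)⟩
    · rintro ⟨z, rfl⟩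
      exact ⟨⟨z, heq.ge z.2⟩, congrArg φ (Subtype.ext rfl)⟩
  have hG_point : ∀ n, n ∈ pt →
      IsQuadraticTransform (φ.comp (Subring.inclusion (hAΛ n))).range
        (φ.comp (Subring.inclusion (hAΛ (n + 1)))).range := by
    intro n hp
    obtain ⟨hB, hfrac, hdom⟩ := hpt n hp
    obtain ⟨hxA, hx0, hxm⟩ := hx n
    haveI := hAN n
    obtain ⟨O, hO⟩ := exists_valuationSubring_dominates (A (n + 1))
    obtain ⟨hA', hAO, hdiv, -⟩ := eq_locAtCentre_of_chart hxA hxm hx0 hB hfrac hdom hO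
    -- `x n ∉ 𝔮 n`, i.e. `φ (x n) ≠ 0`
    have hqt : IsQuadraticTransform (A n) (A (n + 1)) :=
      ⟨inferInstance, ⟨x n, hxA⟩, hxm, fun h => hx0 (congrArg Subtype.val h), inferInstance, hB, hfrac, hdom⟩
    have hneq : (𝔮 (n + 1)).comap (Subring.inclusion hqt.dominates.1) ≠ maximalIdeal (A n) := by
      rw [show hqt.dominates.1 = hle n from rfl, hchain n]; exact hne n
    have hxq' : Subring.inclusion (hle n) ⟨x n, hxA⟩ ∉ 𝔮 (n + 1) :=
      BadCurveStep.not_mem_of_comap_ne_maximalIdeal (hle n) (x := ⟨x n, hxA⟩) hx0 hB (𝔮 (n + 1)) hneq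
    have hxq : (⟨x n, hxA⟩ : A n) ∉ 𝔮 n := by
      rw [← hchain n, Ideal.mem_comap]; exact hxq'
    have hφx : φ ⟨x n, hAΛ n hxA⟩ ≠ 0 := fun h => hxq ((hkerq n _).mpr h)
    have hM1 := LowTower.map_isQuadraticTransform Λ φ hker O (A n) (hAΛ n) hAO (x n) hxA hxm hx0 hdiv hφx
      (by rw [← hA']; exact hAΛ (n + 1)) (by rw [← hA']; exact hdom)
    rw [LineageFrame.range_comp_inclusion_eq_map_comap, LineageFrame.range_comp_inclusion_eq_map_comap]
    have hA'' : ((locAtCentre (blowupRing (A n) (x n)) O).comap Λ.subtype).map φ =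
        ((A (n + 1)).comap Λ.subtype).map φ := by rw [← hA']
    rw [← hA'']
    exact hM1
  /- FRACTIONS: `κ = residue field of V` consists of fractions of `φ(A 0)`. -/
  have hκ : ∀ c : ResidueField V, ∃ a ∈ (φ.comp (Subring.inclusion (hAΛ 0))).range,
      ∃ b ∈ (φ.comp (Subring.inclusion (hAΛ 0))).range, b ≠ 0 ∧ c = a / b := by
    intro c
    obtain ⟨v, rfl⟩ := IsLocalRing.residue_surjective c
    obtain ⟨⟨a, s⟩, rfl⟩ := IsLocalization.mk'_surjective (𝔮 0).primeCompl v
    have hmem : ∀ a : A 0, φ ⟨j (algebraMap (A 0) V a), hjmem _⟩ ∈ (φ.comp (Subring.inclusion (hAΛ 0))).range :=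
      fun a => ⟨a, congrArg φ (Subtype.ext (hjalg a).symm)⟩
    have hs : IsUnit (algebraMap (A 0) V s) := IsLocalization.map_units V s
    have hs0 : IsLocalRing.residue V (algebraMap (A 0) V s) ≠ 0 :=
      (IsLocalRing.residue_ne_zero_iff_isUnit _).mpr hs
    refine ⟨_, hmem a, _, hmem s, ?_, ?_⟩
    · rw [hφj]; exact hs0
    · show IsLocalRing.residue V (IsLocalization.mk' V a s) = _
      rw [hφj, hφj, eq_div_iff hs0, ← map_mul, IsLocalization.mk'_spec]
  /- CONCLUSION by the frame lemma. -/
  have hstep : ∀ n, (φ.comp (Subring.inclusion (hAΛ (n + 1)))).range = (φ.comp (Subring.inclusion (hAΛ n))).range ∨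
      IsQuadraticTransform (φ.comp (Subring.inclusion (hAΛ n))).range
        (φ.comp (Subring.inclusion (hAΛ (n + 1)))).range := by
    intro n
    by_cases hp : n ∈ pt
    · exact Or.inr (hG_point n hp)
    · exact Or.inl (hG_curve n hp)
  have hinf' : ∀ n₀, ∃ n, n₀ ≤ n ∧ IsQuadraticTransform (φ.comp (Subring.inclusion (hAΛ n))).range
      (φ.comp (Subring.inclusion (hAΛ (n + 1)))).range := by
    intro n₀
    obtain ⟨n, hn, hlt⟩ := hinf.exists_gt n₀
    exact ⟨n, hlt.le, hG_point n hn⟩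
  exact LineageFrame.eventually_isRegularLocalRing_quotient_of_frame Λ φ A hAΛ 𝔮 hkerq hκ hloc hNq hdim hfin
    hstep hinf'

end Summit.ResolutionOfSingularities.ResolutionOfSingularities.Theorems.SwitchingDichotomy.LowTamingGerms

end
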